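import Literature.NumberTheory.EllipticCurves.LocalTateSelfDualityTorsionLevelChange
import Literature.NumberTheory.EllipticCurves.WeilPairingLevelCompatProofs
import HarnessLib

/-!
# The compatible tower of Weil pairings on `E[p^k] = geomTorsion W ((p^k : ℕ) : ℤ)`, transitions `torsionMulHom` (proofs)

`Proofs` file (theorems only: no definition, no named fact, no instance, no `sorry`) in topic
`NumberTheory/EllipticCurves`.

The `ℤ_p`-valued local Tate pairing of the tree (`tatePairing`, `tatePairingPoint` of
`LocalTatePairingTateModule.lean` / `LocalTatePairingPoints.lean`, brick K2 of the hT₂ programme of crux K★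
`stmt-BirchSwinnertonDyer-22226`) and its duality theorem `exists_tatePairingPoint_eq` are parametrised by a
LEVEL-COMPATIBLE TOWER OF WEIL PAIRINGS in the following currency (for `W` elliptic over ANY field `K₀` of
characteristic `0`):

  `e : (k : ℕ) → geomTorsion W ((p ^ k : ℕ) : ℤ) → geomTorsion W ((p ^ k : ℕ) : ℤ) → K̄₀`

with `e_k ^ (p^k) = 1`, biadditivity, `Γ_{K₀}`-equivariance `σ • e_k(S,T) = e_k(σS, σT)`, right non-degeneracy,
and the transition law `e_k(pS, pT) = e_{k+1}(S,T)^p` written with `torsionMulHom W (p^(k+1)) (p^k) p _`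
(`LocalTateSelfDualityTorsionLevelChange.lean`). The tree CONSTRUCTS such a tower on `E(K̄₀) = geomPoints W`
under torsion hypotheses (`WeierstrassCurve.exists_weilPairing_tower`, `WeilPairingLevelCompatProofs.lean`:
Silverman *AEC* III.8.1 (a)–(e) for the constructed `weilPairingFun`), and packages it on `geomTorsion W (p^k)`
for `K₀ = ℚ` only (`CyclotomicLayerTatePairing.weilTowerPk`). This file supplies the packaging for every `K₀`:

* ★ `WeierstrassCurve.exists_weilPairing_torsionMul_tower` — for `(p : K₀) ≠ 0` there is ONE family `e` in the
  currency above with all six properties (`hμ`, `hadd₁`, `hadd₂`, `hgal`, `hnondeg`, `hcompat`) consumed by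
  `levelTatePairing` / `tatePairing` / `tatePairingPoint` / `exists_tatePairingPoint_eq` /
  `DualExpEllipticRangeOfTateReciprocity`.
* ★ `WeierstrassCurve.exists_weilPairing_torsionMul_tower_alt` — the same with the levelwise ALTERNATION
  `e_k(S, S) = 1` kept (seven properties; feeds `PAdicHodge.WeilTowerAlternating/Nondegenerate`).

So the `e`-binders of those files are dischargeable for every elliptic curve over a field of characteristic
`0` (consumer: the reduction of hT₂ to the reciprocity law, `exists_smul_range_expStarCoord_tower_iff_trace_log`).
BSD / K★ are not proved by any of this.

## References
* [SilvermanAEC2009] J. H. Silverman, *The Arithmetic of Elliptic Curves*, 2nd ed. (2009), Prop. III.8.1 (a)–(e).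
-/

noncomputable section

open scoped Classical

universe u

namespace WeierstrassCurve

open Literature.NumberTheory.EllipticCurves

variable {K₀ : Type u} [Field K₀] (W : WeierstrassCurve K₀) [W.IsElliptic] {p : ℕ}

omit [W.IsElliptic] in
/-- A point of `E[p^k]` is killed by `p^k` (`ℕ`-cast index, the torsion hypothesis of `exists_weilPairing_tower`). [folklore] -/
private theorem zsmul_coe_geomTorsion_natPow (k : ℕ) (S : geomTorsion W ((p ^ k : ℕ) : ℤ)) :
    ((p ^ k : ℕ) : ℤ) • (S : geomPoints W) = 0 :=
  (mem_geomTorsion_iff W _ _).mp S.2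

/-- ★ **The compatible tower of Weil pairings on `geomTorsion W (p^k)`, transitions `torsionMulHom`.** For an
elliptic curve `W` over a field `K₀` with `p ≠ 0` in `K₀` there is ONE family
`e_k : E[p^k] × E[p^k] → K̄₀` (`E[p^k] = geomTorsion W ((p^k : ℕ) : ℤ)`) with, at every level, `e_k(S,T)^{p^k} = 1`,
additivity in both arguments, `Γ_{K₀}`-equivariance `σ • e_k(S,T) = e_k(σS, σT)` and right non-degeneracy, and
COMPATIBLE along `torsionMulHom W (p^(k+1)) (p^k) p` (multiplication by `p`): `e_k(pS, pT) = e_{k+1}(S,T)^p`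
(Silverman, *AEC*, Prop. III.8.1 (a)–(e); the family is the tree's constructed `weilPairingFun`,
`exists_weilPairing_tower`, read on the torsion subgroups). These are exactly the binders
`(e, hμ, hadd₁, hadd₂, hgal, hnondeg, hcompat)` of `levelTatePairing`, `tatePairing`, `tatePairingPoint`,
`exists_tatePairingPoint_eq`. [cite: SilvermanAEC2009, Prop. III.8.1 (a)–(e)] -/
theorem exists_weilPairing_torsionMul_tower (hpK : (p : K₀) ≠ 0) :
    ∃ e : (k : ℕ) → geomTorsion W ((p ^ k : ℕ) : ℤ) → geomTorsion W ((p ^ k : ℕ) : ℤ) → AlgebraicClosure K₀,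
      (∀ k S T, e k S T ^ (p ^ k) = 1) ∧
      (∀ k S₁ S₂ T, e k (S₁ + S₂) T = e k S₁ T * e k S₂ T) ∧
      (∀ k S T₁ T₂, e k S (T₁ + T₂) = e k S T₁ * e k S T₂) ∧
      (∀ k (σ : Field.absoluteGaloisGroup K₀) (S T : geomTorsion W ((p ^ k : ℕ) : ℤ)),
        σ • e k S T = e k (σ • S) (σ • T)) ∧
      (∀ k (T : geomTorsion W ((p ^ k : ℕ) : ℤ)), (∀ S, e k S T = 1) → T = 0) ∧
      (∀ k (S T : geomTorsion W ((p ^ (k + 1) : ℕ) : ℤ)),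
        e k (torsionMulHom W (p ^ (k + 1)) (p ^ k) p (pow_succ p k).symm S)
          (torsionMulHom W (p ^ (k + 1)) (p ^ k) p (pow_succ p k).symm T) = e (k + 1) S T ^ p) := by
  obtain ⟨e, hpow, hadd₁, hadd₂, -, hnd, hgal, hsucc⟩ := exists_weilPairing_tower (W := W) hpK
  refine ⟨fun k S T => e k (S : geomPoints W) (T : geomPoints W), ?_, ?_, ?_, ?_, ?_, ?_⟩
  · exact fun k S T => hpow k _ _ (zsmul_coe_geomTorsion_natPow W k S) (zsmul_coe_geomTorsion_natPow W k T)
  · exact fun k S₁ S₂ T => hadd₁ k _ _ _ (zsmul_coe_geomTorsion_natPow W k S₁)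
      (zsmul_coe_geomTorsion_natPow W k S₂) (zsmul_coe_geomTorsion_natPow W k T)
  · exact fun k S T₁ T₂ => hadd₂ k _ _ _ (zsmul_coe_geomTorsion_natPow W k S)
      (zsmul_coe_geomTorsion_natPow W k T₁) (zsmul_coe_geomTorsion_natPow W k T₂)
  · intro k σ S T
    change σ • e k (S : geomPoints W) (T : geomPoints W) =
      e k ((σ • S : geomTorsion W ((p ^ k : ℕ) : ℤ)) : geomPoints W) ((σ • T : geomTorsion W _) : geomPoints W)
    rw [AddSubgroup.torsionBy.coe_smul, AddSubgroup.torsionBy.coe_smul]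
    exact (hgal k σ _ _ (zsmul_coe_geomTorsion_natPow W k S) (zsmul_coe_geomTorsion_natPow W k T)).symm
  · intro k T hT
    exact Subtype.ext (hnd k _ (zsmul_coe_geomTorsion_natPow W k T) fun S hS =>
      hT ⟨S, (mem_geomTorsion_iff W _ _).mpr hS⟩)
  · intro k S T
    change e k ((torsionMulHom W (p ^ (k + 1)) (p ^ k) p (pow_succ p k).symm S : geomTorsion W _) : geomPoints W)
        ((torsionMulHom W (p ^ (k + 1)) (p ^ k) p (pow_succ p k).symm T : geomTorsion W _) : geomPoints W) =
      e (k + 1) (S : geomPoints W) (T : geomPoints W) ^ p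
    rw [coe_torsionMulHom, coe_torsionMulHom]
    exact hsucc k _ _ (zsmul_coe_geomTorsion_natPow W (k + 1) S) (zsmul_coe_geomTorsion_natPow W (k + 1) T)

/-- ★ **The same tower WITH LEVELWISE ALTERNATION `e_k(S, S) = 1`** (Silverman *AEC* III.8.1 (c), kept from
`exists_weilPairing_tower` instead of discarded): seven properties (`hμ`, `hadd₁`, `hadd₂`, `hgal`, `hnondeg`, `halt`,
`hcompat`). The extra law is what `PAdicHodge.WeilTowerAlternating` (`weilContPairingPadic_toLin_self / _smul_left`) and
`PAdicHodge.WeilTowerNondegenerate` turn into the binders `healt` / `heL` / `henondeg` of Kato's explicit reciprocity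
law in the tree (`TatePairingPointOfKTwo…`, `…TransportedReciprocityAllPoints`). [cite: SilvermanAEC2009, Prop. III.8.1 (a)–(e)] -/
theorem exists_weilPairing_torsionMul_tower_alt (hpK : (p : K₀) ≠ 0) :
    ∃ e : (k : ℕ) → geomTorsion W ((p ^ k : ℕ) : ℤ) → geomTorsion W ((p ^ k : ℕ) : ℤ) → AlgebraicClosure K₀,
      (∀ k S T, e k S T ^ (p ^ k) = 1) ∧
      (∀ k S₁ S₂ T, e k (S₁ + S₂) T = e k S₁ T * e k S₂ T) ∧
      (∀ k S T₁ T₂, e k S (T₁ + T₂) = e k S T₁ * e k S T₂) ∧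
      (∀ k (σ : Field.absoluteGaloisGroup K₀) (S T : geomTorsion W ((p ^ k : ℕ) : ℤ)),
        σ • e k S T = e k (σ • S) (σ • T)) ∧
      (∀ k (T : geomTorsion W ((p ^ k : ℕ) : ℤ)), (∀ S, e k S T = 1) → T = 0) ∧
      (∀ k (S : geomTorsion W ((p ^ k : ℕ) : ℤ)), e k S S = 1) ∧
      (∀ k (S T : geomTorsion W ((p ^ (k + 1) : ℕ) : ℤ)),
        e k (torsionMulHom W (p ^ (k + 1)) (p ^ k) p (pow_succ p k).symm S)
          (torsionMulHom W (p ^ (k + 1)) (p ^ k) p (pow_succ p k).symm T) = e (k + 1) S T ^ p) := by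
  obtain ⟨e, hpow, hadd₁, hadd₂, halt, hnd, hgal, hsucc⟩ := exists_weilPairing_tower (W := W) hpK
  refine ⟨fun k S T => e k (S : geomPoints W) (T : geomPoints W), ?_, ?_, ?_, ?_, ?_, ?_, ?_⟩
  · exact fun k S T => hpow k _ _ (zsmul_coe_geomTorsion_natPow W k S) (zsmul_coe_geomTorsion_natPow W k T)
  · exact fun k S₁ S₂ T => hadd₁ k _ _ _ (zsmul_coe_geomTorsion_natPow W k S₁)
      (zsmul_coe_geomTorsion_natPow W k S₂) (zsmul_coe_geomTorsion_natPow W k T)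
  · exact fun k S T₁ T₂ => hadd₂ k _ _ _ (zsmul_coe_geomTorsion_natPow W k S)
      (zsmul_coe_geomTorsion_natPow W k T₁) (zsmul_coe_geomTorsion_natPow W k T₂)
  · intro k σ S T
    change σ • e k (S : geomPoints W) (T : geomPoints W) =
      e k ((σ • S : geomTorsion W ((p ^ k : ℕ) : ℤ)) : geomPoints W) ((σ • T : geomTorsion W _) : geomPoints W)
    rw [AddSubgroup.torsionBy.coe_smul, AddSubgroup.torsionBy.coe_smul]
    exact (hgal k σ _ _ (zsmul_coe_geomTorsion_natPow W k S) (zsmul_coe_geomTorsion_natPow W k T)).symm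
  · intro k T hT
    exact Subtype.ext (hnd k _ (zsmul_coe_geomTorsion_natPow W k T) fun S hS =>
      hT ⟨S, (mem_geomTorsion_iff W _ _).mpr hS⟩)
  · exact fun k S => halt k _ (zsmul_coe_geomTorsion_natPow W k S)
  · intro k S T
    change e k ((torsionMulHom W (p ^ (k + 1)) (p ^ k) p (pow_succ p k).symm S : geomTorsion W _) : geomPoints W)
        ((torsionMulHom W (p ^ (k + 1)) (p ^ k) p (pow_succ p k).symm T : geomTorsion W _) : geomPoints W) =
      e (k + 1) (S : geomPoints W) (T : geomPoints W) ^ p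
    rw [coe_torsionMulHom, coe_torsionMulHom]
    exact hsucc k _ _ (zsmul_coe_geomTorsion_natPow W (k + 1) S) (zsmul_coe_geomTorsion_natPow W (k + 1) T)

end WeierstrassCurve

end
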